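import Literature.MathematicalPhysics.QuantumFieldTheory.Balaban1983to89.B7Eq92Concrete
import Literature.MathematicalPhysics.QuantumFieldTheory.Balaban1983to89.B7Eq78Linearization

/-!
# Bałaban's renormalization group for 4-d lattice Yang–Mills — B7 Sect. D at a GENERAL BACKGROUND `V₀`, first piece:
the ROTATED ABELIAN FUNCTIONAL `(R_{0,y}A)(Γ)` (p. 28: "R_{0,c₋}A is defined as R_{0,c₋}V′, only the product over b is
replaced by the sum") for B7's own twisted transport (58) on `ℤ^d`, and (111) TO FIRST ORDER: it IS the `t`-derivative at
`0` of `(R_{0,y}e^{tA})(Γ)` and of its series logarithm, for every contour and every background (`B7Prop3GeneralRotated`)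

CITATION HEADER (lean-in-tree rule 2026-08-18).  Audit cell `pub-balaban`, sub-cell `t4` (NE7c ROUND-2 crew, seat
`b2b-balaban-t4-ne7c-formalise-leaf-05` gen 6; owner table `t4/b2b-balaban-t4-ne7c-p1/LEAVES-NE7c-P1.md` v2.3 row S55
«[B7] PROPOSITION 3 AT A GENERAL REGULAR BACKGROUND», WALL §2 (a) item `Cf` = B11's citation of [Balaban1985Averaging]
Prop. 4 (owner FINDING F-ne7cp1-g28-1); custody notice to the b07 lineage journalled before filing).  Source: T. Bałaban,
*Averaging operations for lattice gauge theories*, Commun. Math. Phys. **98**, 17–51 (1985) [Balaban1985Averaging]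
(cell paper B7; journal page = PDF page + 16), Sect. B p. 27–28 [PDF 11–12] ((56)–(58), the sentence after (61)) and
Sect. D p. 34 [PDF 18] ((109)–(112)), quoted from the page renders
`b2b-balaban-ref1/pages/1985-cmp98-averaging/1985-cmp98-averaging-p018-x2.png` (READ AS AN IMAGE by this seat,
2026-08-20) and, for pp. 27–28, from the verbatim quotations in the module docstrings of `B7Eq92Concrete` (gen 19 of
the b07 lineage) and `B7Prop3Flat` (gens 16–18).
Companions (all REUSED BY NAME, none modified): `B7Eq92Concrete` (the twisted transport (58) `tHol`, the rotation (56)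
`Rc`), `B7Prop1Explicit` (`hol` (9), `stepHol`, `Letter`, `stepA`/`asum` — the abelian functional `A(Γ)` of p. 24 —,
`U1`, `stepHol_mem`, `hol_mem`), `B7Prop3Flat` (`expCfg` — the configuration `V₁ = e^{A}` of (109)),
`B7Eq78Linearization` (`conjR` — (56) on the algebra —, and its calculus §: `hasDerivAt_mlog_comp`,
`hasDerivAt_exp_smul_zero`), `MatrixLog` (`mlog` = the series (21)).

THE PRINTED TEXT (verbatim from the renders).  p. 27 (56): "R(X)Y = XYX⁻¹", (57): "R(X)f(Y) = f(R(X)Y) for analytic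
functions f, R(X)R(Y) = R(XY), R(X)⁻¹ = R(X⁻¹), R(X)* = R(X*)", (58): "(R_{0,y}V′)(Γ_{y,x}) = ∏_{b⊂Γ_{y,x}}
R(V₀(Γ_{y,b₋}))V′_b".  p. 28, after (61): "a good approximation of the function (1/i) log(\overline{V′V₀})_c(V̄₀)_c⁻¹ for
V′ = e^{iA}, A small, is given by (Q₀A)(c) = Σ_{x∈B(c₋)} L^{−d}(R_{0,c₋}A)([x, x(c)]), where R_{0,c₋}A is defined as
R_{0,c₋}V′, only the product over b is replaced by the sum."  p. 34: "We assume that the configurations V₀, V₁ satisfy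
the conditions |V₀(∂p) − 1| < α₀, V_{1,b} = e^{iA_b}, |A_b| < α₁, p, b ⊂ Ω′, (109) and A_b belong to the complexified Lie
algebra 𝔤^c."; (110): "\overline{R_{0,y}V₁} = exp[i Σ_{x∈B(y)} L^{−d} (1/i) log(R_{0,y}V₁)(Γ_{y,x})], y ∈ Ω′^{(1)}."; "We
have (1/i) log(R_{0,y}V₁)(Γ_{y,x}) = (R_{0,y}A)(Γ_{y,x}) + O((|A|(Γ_{y,x}))²), (111) hence \overline{R_{0,y}V₁} =
exp[i Σ_{x∈B(y)} L^{−d}(R_{0,y}A)(Γ_{y,x}) + O(L²α₁²)]. (112)".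

DICTIONARY print ↦ Lean (conventions of the b07 lineage: `B7Prop1Explicit`/`B7Prop3Flat`/`B7Eq92Concrete`).  Bond
values in the units `𝔸ˣ` of a complete normed `ℂ`-algebra `𝔸` (for `M_N(ℂ)`), `𝔤^c` ↦ `𝔸`, the `i` of `e^{iA}` absorbed
into `A` (`expCfg A`); words `Γ` = lists of letters `(μ, ±)` from a base point, `V(Γ)` = `hol V y Γ` (9); the background
transport `V₀(Γ_{y,b₋})` = `hol V₀ y (prefix)`; (56) on the algebra `R(X)Y` ↦ `conjR X Y`; (58) ↦ `B7Eq92Concrete.tHol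
V₀ V′ y Γ` (DEFINED there as `(V′V₀)(Γ)V₀(Γ)⁻¹` and PROVED equal to the printed product); **`(R_{0,y}A)(Γ)` ↦
`tsum V₀ A y Γ`**, DEFINED by the recursion along the word — for the letter `+e_μ` at `x` the summand `A_{⟨x,x+e_μ⟩}`, for a
reversed letter `−R(V₀(b)⁻¹)A_b` (the reading of (58) forced by (9) `U(−b) = U(b)⁻¹`, as `B7Eq92Concrete.tHol_append_false`),
each tail rotated by `R` of the background bond just traversed — and PROVED to be the printed "product replaced by the
sum" for positively oriented contours (`tsum_append_true`: appending `b` adds `R(V₀(Γ_{y,b₋}))A_b`).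

WHAT THIS FILE PROVES (kernel, no `sorry`, standard axioms; NO hypotheses except where displayed):
* §1 `tsum` and its algebra: `tsum_one_left` (at `V₀ = 1`, `(R_{0,y}A)(Γ) = A(Γ)` = `asum`), `tsum_append`
  (`(R_{0,y}A)(Γ₁∪Γ₂) = (R_{0,y}A)(Γ₁) + R(V₀(Γ₁))(R_{0,y+Γ₁}A)(Γ₂)`), `tsum_append_true` (the printed shape),
  `norm_tsum_le` (`‖(R_{0,y}A)(Γ)‖ ≤ |Γ|·a` for `|A_b| ≤ a` over a background in `U1` — `‖V₀(b)‖, ‖V₀(b)⁻¹‖ ≤ 1`, e.g.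
  unitary —: the rotations do not increase norms, `norm_conjR_le`).
* §2 **(111) to first order, as exact derivative statements** along the ray `V′ = e^{tA}`, `t ∈ ℂ`:
  `hasDerivAt_stepHol_expCfg` (one bond), `hasDerivAt_hol_expCfg_mul` (`d/dt|₀ (e^{tA}V₀)(Γ) = (R_{0,y}A)(Γ)·V₀(Γ)` — the
  recursion defining `tsum` IS the product rule along the word), **`hasDerivAt_tHol_expCfg`**
  (`d/dt|₀ (R_{0,y}e^{tA})(Γ) = (R_{0,y}A)(Γ)`), **`hasDerivAt_mlog_tHol_expCfg`** (`d/dt|₀ log (R_{0,y}e^{tA})(Γ) =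
  (R_{0,y}A)(Γ)`: the curve passes through `1`, where `D log = id`).
ABSOLUTE-RULE LEDGER.  No hypotheses beyond the displayed `U1`/norm binders of `norm_tsum_le`; no `B7.Prop*` placeholder,
no Literature `Prop`-fact, nothing of the manuscript cited as a fact; one new definition (`tsum`, with its letter
summand `tstep`), everything else the lineage's objects.
NOT CERTIFIED HERE (located).  The quantitative `O((|A|(Γ))²)` of (111) and `O(L²α₁²)` of (112) (second-order Taylor
remainders — the analyticity half of Prop. 3, owner table rows S55-analytic∕S58); (113)–(126) (the sequel
`B7Prop3GeneralLinear` treats the frames (110)/(112), the main term (125) and the objects (121)–(122); the closed form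
(124) of the linear part and the bound (126) are the next step); unitarity∕reality ((57) `R(X)* = R(X*)`).
DIVERGENCES from print (cell DIVERGENCE.md, row to be filed with the LANDED line).  (a) `(R_{0,y}A)(Γ)` is DEFINED by
the recursion (equivalently: as the derivative it is proved to be) for ARBITRARY words, print defines it by the displayed
sum for the tree contours (positively oriented); the two agree there (`tsum_append_true`).  (b) Setting as in the
lineage: `ℤ^d`, units of a complete normed `ℂ`-algebra, no smallness (every statement of this file is an identity or a
derivative AT `t = 0`, valid for all `A`, `V₀`).  (c) (111) is rendered as the derivative at `0` along complex rays
`t ↦ e^{tA}`, not as a Taylor estimate.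
VALUE.  The linear-algebra∕calculus substrate of Prop. 3 at a curved background for the paper's own transport (58):
the object `R_{0,c₋}A` of (112)–(125) kernel-defined with its derivative characterisation; NOT summit progress (NE7c NOT
PROVED; spine PROVED 0∕9; rung (B)+1 on a finite T⁴ — NOT infinite volume, NOT mass gap, NOT Clay).
-/

noncomputable section

open scoped BigOperators
open NormedSpace Finset

namespace Literature.MathematicalPhysics.QuantumFieldTheory.Balaban1983to89.B7Prop3GeneralRotated

open B7Prop1Explicit B7Prop3Flat B7Eq92Concrete MatrixLog
open B7Eq78Linearization (conjR conjR_apply conjR_add conjR_one hasDerivAt_mlog_comp hasDerivAt_exp_smul_zero)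
open B8Ineq130 (hol_one)

-- `Site` alone would resolve to the torus sites of `Setup.lean`; re-export the `ℤ^d` sites of `B7Prop1Explicit`.
export B7Prop1Explicit (Site)

variable {d : ℕ}

variable {𝔸 : Type*} [NormedRing 𝔸] [NormedAlgebra ℂ 𝔸] [CompleteSpace 𝔸]

/-! ## §1 The rotated abelian functional `(R_{0,y}A)(Γ)` — the linearisation of the twisted transport (58) -/

section Rotated

omit [NormedAlgebra ℂ 𝔸] [CompleteSpace 𝔸] in
/-- `R(XY) = R(X)R(Y)` on the algebra ((57) "R(X)R(Y) = R(XY)"). [cite: Balaban1985Averaging, (57) p.27] -/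
theorem conjR_mul_left (X Y : 𝔸ˣ) (Z : 𝔸) : conjR (X * Y) Z = conjR X (conjR Y Z) := by
  simp only [conjR_apply, Units.val_mul, mul_inv_rev, mul_assoc]

omit [NormedAlgebra ℂ 𝔸] [CompleteSpace 𝔸] in
/-- `R(X)` is norm-non-increasing for a unit with `‖X‖, ‖X⁻¹‖ ≤ 1` (the class `U1` of the lineage; unitaries) — the norm
side of (57)'s properties of the rotations, used for "|(Q₀A)_c| ≤ |A|" (126). [cite: Balaban1985Averaging, (56)–(57) p.27, (126) p.36] -/
theorem norm_conjR_le [NormOneClass 𝔸] {u : 𝔸ˣ} (hu : u ∈ U1 𝔸) (X : 𝔸) : ‖conjR u X‖ ≤ ‖X‖ := by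
  rw [conjR_apply]
  obtain ⟨h1, h2⟩ := mem_U1.1 hu
  calc ‖(u : 𝔸) * X * ((u⁻¹ : 𝔸ˣ) : 𝔸)‖ ≤ ‖(u : 𝔸)‖ * ‖X‖ * ‖((u⁻¹ : 𝔸ˣ) : 𝔸)‖ :=
        (norm_mul_le _ _).trans (mul_le_mul_of_nonneg_right (norm_mul_le _ _) (norm_nonneg _))
    _ ≤ 1 * ‖X‖ * 1 := by gcongr
    _ = ‖X‖ := by ring

omit [NormedAlgebra ℂ 𝔸] [CompleteSpace 𝔸] in
/-- The contribution of ONE letter to `(R_{0,y}A)(Γ)`: `A_b` for a positively oriented bond (the rotation `R(V₀(Γ_{y,b₋}))`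
is supplied by the recursion), `−R(V₀(b)⁻¹)A_b` for a reversed one (convention (9) `U(−b) = U(b)⁻¹` applied to
`V′V₀`, as in `B7Eq92Concrete.tHol_append_false`); at `V₀ = 1` it is `B7Prop1Explicit.stepA`. [cite: Balaban1985Averaging, (58) p.27, p.28] -/
def tstep (V₀ : Site d → Fin d → 𝔸ˣ) (A : Site d → Fin d → 𝔸) (x : Site d) (l : Letter d) : 𝔸 :=
  if l.2 then A x l.1 else -conjR (stepHol V₀ x l) (A (x + l.vec) l.1)

omit [NormedAlgebra ℂ 𝔸] [CompleteSpace 𝔸] in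
/-- **`(R_{0,y}A)(Γ)`** — p. 28, after (61): "R_{0,c₋}A is defined as R_{0,c₋}V′, only the product over b is replaced by
the sum", i.e. by (58) `(R_{0,y}A)(Γ) = Σ_{b⊂Γ} R(V₀(Γ_{y,b₋}))A_b` for a contour of positively oriented bonds
(`tsum_append_true`); defined recursively along the word `Γ` from `y` (each further letter rotated by the background
transport already traversed), for arbitrary words. [cite: Balaban1985Averaging, p.28, (58) p.27] -/
def tsum (V₀ : Site d → Fin d → 𝔸ˣ) (A : Site d → Fin d → 𝔸) : Site d → List (Letter d) → 𝔸
  | _, [] => 0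
  | x, l :: w => tstep V₀ A x l + conjR (stepHol V₀ x l) (tsum V₀ A (x + l.vec) w)

omit [NormedAlgebra ℂ 𝔸] [CompleteSpace 𝔸] in
/-- `(R_{0,y}A)(∅) = 0`: the recursion of the printed sum, empty contour. [cite: Balaban1985Averaging, (58) p.27, p.28] -/
@[simp] theorem tsum_nil (V₀ : Site d → Fin d → 𝔸ˣ) (A : Site d → Fin d → 𝔸) (x : Site d) : tsum V₀ A x [] = 0 := rfl

omit [NormedAlgebra ℂ 𝔸] [CompleteSpace 𝔸] in
/-- the recursion of the printed sum `(R_{0,y}A)(Γ)`, one letter. [cite: Balaban1985Averaging, (58) p.27, p.28] -/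
@[simp] theorem tsum_cons (V₀ : Site d → Fin d → 𝔸ˣ) (A : Site d → Fin d → 𝔸) (x : Site d) (l : Letter d)
    (w : List (Letter d)) :
    tsum V₀ A x (l :: w) = tstep V₀ A x l + conjR (stepHol V₀ x l) (tsum V₀ A (x + l.vec) w) := rfl

omit [NormedAlgebra ℂ 𝔸] [CompleteSpace 𝔸] in
/-- at the flat background the letter contribution is `stepA` (`R = id`; p. 34 "(R_{0,y}V₁)(Γ_{y,x}) = V₁(Γ_{y,x})"). [cite: Balaban1985Averaging, (110)–(111) p.34] -/
@[simp] theorem tstep_one_left (A : Site d → Fin d → 𝔸) (x : Site d) (l : Letter d) :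
    tstep (1 : Site d → Fin d → 𝔸ˣ) A x l = stepA A x l := by
  unfold tstep stepA stepHol
  split_ifs <;> simp [conjR_apply]

omit [NormedAlgebra ℂ 𝔸] [CompleteSpace 𝔸] in
/-- **at `V₀ = 1`, `(R_{0,y}A)(Γ) = A(Γ)`** (p. 34: "(R_{0,y}V₁)(Γ_{y,x}) = V₁(Γ_{y,x})" at the flat background; the sum
is `B7Prop1Explicit.asum`). [cite: Balaban1985Averaging, p.28, (110)–(111) p.34] -/
@[simp] theorem tsum_one_left (A : Site d → Fin d → 𝔸) : ∀ (x : Site d) (w : List (Letter d)),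
    tsum (1 : Site d → Fin d → 𝔸ˣ) A x w = asum A x w
  | x, [] => rfl
  | x, l :: w => by
    rw [tsum_cons, asum_cons, tsum_one_left A (x + l.vec) w, tstep_one_left]
    simp [stepHol, conjR_apply]

omit [NormedAlgebra ℂ 𝔸] [CompleteSpace 𝔸] in
/-- **concatenation**: `(R_{0,y}A)(Γ₁ ∪ Γ₂) = (R_{0,y}A)(Γ₁) + R(V₀(Γ₁))·(R_{0,y+Γ₁}A)(Γ₂)` — the second contour is
rotated by the background transport along the first. [cite: Balaban1985Averaging, (58) p.27, p.28] -/
theorem tsum_append (V₀ : Site d → Fin d → 𝔸ˣ) (A : Site d → Fin d → 𝔸) : ∀ (x : Site d) (w₁ w₂ : List (Letter d)),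
    tsum V₀ A x (w₁ ++ w₂) = tsum V₀ A x w₁ + conjR (hol V₀ x w₁) (tsum V₀ A (x + disp w₁) w₂)
  | x, [], w₂ => by simp [conjR_apply]
  | x, l :: w₁, w₂ => by
    rw [List.cons_append, tsum_cons, tsum_cons, tsum_append V₀ A (x + l.vec) w₁ w₂, hol_cons, conjR_mul_left,
      conjR_add, disp_cons, add_assoc, add_assoc]

omit [NormedAlgebra ℂ 𝔸] [CompleteSpace 𝔸] in
/-- **(58) with "the product over b replaced by the sum", VERBATIM SHAPE**: appending the positively oriented bond
`b = ⟨x, x + e_μ⟩`, `x = y + disp Γ`, adds `R(V₀(Γ_{y,b₋}))A_b`; so for a contour of positively oriented bonds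
`(R_{0,y}A)(Γ) = Σ_{b⊂Γ} R(V₀(Γ_{y,b₋}))A_b` in the order of `Γ` (companion of `B7Eq92Concrete.tHol_append_true`).
[cite: Balaban1985Averaging, (58) p.27, p.28] -/
theorem tsum_append_true (V₀ : Site d → Fin d → 𝔸ˣ) (A : Site d → Fin d → 𝔸) (y : Site d) (w : List (Letter d))
    (μ : Fin d) : tsum V₀ A y (w ++ [(μ, true)]) = tsum V₀ A y w + conjR (hol V₀ y w) (A (y + disp w) μ) := by
  rw [tsum_append, tsum_cons, tsum_nil]
  simp [tstep, conjR_apply]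

omit [NormedAlgebra ℂ 𝔸] [CompleteSpace 𝔸] in
/-- **norm bound**: over a background with `‖V₀(b)‖, ‖V₀(b)⁻¹‖ ≤ 1` (class `U1`; unitaries) and `|A_b| ≤ a`,
`‖(R_{0,y}A)(Γ)‖ ≤ |Γ|·a` — the rotations do not increase norms (the ingredient of "|(Q₀A)_c| ≤ |A|", (126)).
[cite: Balaban1985Averaging, (125)–(126) p.36] -/
theorem norm_tsum_le [NormOneClass 𝔸] {V₀ : Site d → Fin d → 𝔸ˣ} (hV₀ : ∀ x κ, V₀ x κ ∈ U1 𝔸)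
    {A : Site d → Fin d → 𝔸} {a : ℝ} (hA : ∀ x κ, ‖A x κ‖ ≤ a) :
    ∀ (x : Site d) (w : List (Letter d)), ‖tsum V₀ A x w‖ ≤ w.length * a
  | x, [] => by simp
  | x, l :: w => by
    rw [tsum_cons, List.length_cons, Nat.cast_succ, add_mul, one_mul, add_comm ((w.length : ℝ) * a)]
    refine (norm_add_le _ _).trans (add_le_add ?_ ?_)
    · unfold tstep
      split_ifs
      · exact hA _ _
      · rw [norm_neg]
        exact (norm_conjR_le (stepHol_mem hV₀ x l) _).trans (hA _ _)
    · exact (norm_conjR_le (stepHol_mem hV₀ x l) _).trans (norm_tsum_le hV₀ hA (x + l.vec) w)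

end Rotated

/-! ## §2 `(R_{0,y}A)(Γ)` IS the derivative of the twisted transport (58) along `V′ = e^{tA}` — (111) to first order -/

section Derivative

omit [CompleteSpace 𝔸] in
/-- `e^{0} = 1` bondwise: the configuration `V₁ = e^{A}` (109) at `A = 0` is the unit configuration. [cite: Balaban1985Averaging, (109) p.34] -/
@[simp] theorem expCfg_zero [CompleteSpace 𝔸] : expCfg (0 : Site d → Fin d → 𝔸) = 1 := by
  funext x κ
  exact Units.ext (by simp [expCfg])

/-- along the ray `V′ = e^{tA}`: at `t = 0` the configuration `V′V₀` is the background `V₀` (p. 27 "V = V′V₀"). [cite: Balaban1985Averaging, (109) p.34, (55) p.27] -/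
theorem expCfg_zero_smul_mul (A : Site d → Fin d → 𝔸) (V₀ : Site d → Fin d → 𝔸ˣ) :
    expCfg ((0 : ℂ) • A) * V₀ = V₀ := by
  rw [zero_smul, expCfg_zero, one_mul]

/-- **one bond**: the bond variable of `e^{tA}V₀` traversed by the letter `l` has `t`-derivative
`(tstep V₀ A x l)·V₀(l)` at `t = 0` (`A_b V₀(b)` forwards, `−V₀(b)⁻¹A_b = (−R(V₀(b)⁻¹)A_b)·V₀(b)⁻¹` backwards) —
(111) for a one-bond contour. [cite: Balaban1985Averaging, (111) p.34, (9) p.18] -/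
theorem hasDerivAt_stepHol_expCfg (V₀ : Site d → Fin d → 𝔸ˣ) (A : Site d → Fin d → 𝔸) (x : Site d) (l : Letter d) :
    HasDerivAt (fun t : ℂ => ((stepHol (expCfg (t • A) * V₀) x l : 𝔸ˣ) : 𝔸))
      (tstep V₀ A x l * ((stepHol V₀ x l : 𝔸ˣ) : 𝔸)) 0 := by
  obtain ⟨μ, b⟩ := l
  cases b
  · -- reversed bond `(μ, false)`: value `V₀(b)⁻¹ · e^{−tA_b}`
    have hval : ∀ t : ℂ, ((stepHol (expCfg (t • A) * V₀) x (μ, false) : 𝔸ˣ) : 𝔸)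
        = (((V₀ (x + Letter.vec (μ, false)) μ)⁻¹ : 𝔸ˣ) : 𝔸) * exp (t • (-A (x + Letter.vec (μ, false)) μ)) := by
      intro t
      simp only [stepHol, Bool.false_eq_true, ↓reduceIte, Pi.mul_apply, expCfg, Pi.smul_apply, mul_inv_rev,
        Units.val_mul, val_inv_expUnit, val_expUnit, smul_neg]
    simp_rw [hval]
    have h := (hasDerivAt_exp_smul_zero (-A (x + Letter.vec (μ, false)) μ)).const_mul
      ((((V₀ (x + Letter.vec (μ, false)) μ)⁻¹ : 𝔸ˣ) : 𝔸))
    refine h.congr_deriv ?_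
    simp only [tstep, Bool.false_eq_true, ↓reduceIte, stepHol, conjR_apply, mul_neg, neg_mul, inv_inv,
      Units.mul_inv_cancel_right]
  · -- positive bond `(μ, true)`: value `e^{tA_b} · V₀(b)`
    have hval : ∀ t : ℂ, ((stepHol (expCfg (t • A) * V₀) x (μ, true) : 𝔸ˣ) : 𝔸)
        = exp (t • A x μ) * ((V₀ x μ : 𝔸ˣ) : 𝔸) := by
      intro t
      simp only [stepHol, ↓reduceIte, Pi.mul_apply, expCfg, Pi.smul_apply, Units.val_mul, val_expUnit]
    simp_rw [hval]
    have h := (hasDerivAt_exp_smul_zero (A x μ)).mul_const (((V₀ x μ : 𝔸ˣ) : 𝔸))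
    refine h.congr_deriv ?_
    simp only [tstep, ↓reduceIte, stepHol]

/-- **the whole contour**: `d/dt|₀ (e^{tA}V₀)(Γ) = (R_{0,y}A)(Γ) · V₀(Γ)` — the recursion defining `tsum` is exactly the
product rule along the word ((111) before removing the background transport). [cite: Balaban1985Averaging, (111) p.34, (58) p.27] -/
theorem hasDerivAt_hol_expCfg_mul (V₀ : Site d → Fin d → 𝔸ˣ) (A : Site d → Fin d → 𝔸) :
    ∀ (x : Site d) (w : List (Letter d)),
      HasDerivAt (fun t : ℂ => ((hol (expCfg (t • A) * V₀) x w : 𝔸ˣ) : 𝔸))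
        (tsum V₀ A x w * ((hol V₀ x w : 𝔸ˣ) : 𝔸)) 0
  | x, [] => by
    simp only [hol_nil, Units.val_one, tsum_nil, zero_mul]
    exact hasDerivAt_const (0 : ℂ) (1 : 𝔸)
  | x, l :: w => by
    have hS := hasDerivAt_stepHol_expCfg V₀ A x l
    have hH := hasDerivAt_hol_expCfg_mul V₀ A (x + l.vec) w
    have h := hS.fun_mul hH
    simp only [expCfg_zero_smul_mul] at h
    simp only [hol_cons, Units.val_mul]
    refine h.congr_deriv ?_
    rw [tsum_cons, add_mul, conjR_apply]
    simp only [mul_assoc, Units.inv_mul_cancel_left]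

/-- at `t = 0` the twisted transport (58) of `e^{tA}` is `1` (`(V₀)(Γ)V₀(Γ)⁻¹`). [cite: Balaban1985Averaging, (58) p.27] -/
theorem tHol_expCfg_zero_smul (V₀ : Site d → Fin d → 𝔸ˣ) (A : Site d → Fin d → 𝔸) (x : Site d)
    (w : List (Letter d)) : tHol V₀ (expCfg ((0 : ℂ) • A)) x w = 1 := by
  rw [zero_smul, expCfg_zero, tHol, one_mul, mul_inv_cancel]

/-- **`(R_{0,y}A)(Γ) = d/dt|₀ (R_{0,y}e^{tA})(Γ)`**: the rotated abelian functional IS the linearisation of the twisted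
transport (58) `(R_{0,y}V′)(Γ) = (V′V₀)(Γ)V₀(Γ)⁻¹` (`B7Eq92Concrete.tHol`) along `V′ = e^{tA}`. [cite: Balaban1985Averaging, (58) p.27, p.28, (111) p.34] -/
theorem hasDerivAt_tHol_expCfg (V₀ : Site d → Fin d → 𝔸ˣ) (A : Site d → Fin d → 𝔸) (x : Site d)
    (w : List (Letter d)) :
    HasDerivAt (fun t : ℂ => ((tHol V₀ (expCfg (t • A)) x w : 𝔸ˣ) : 𝔸)) (tsum V₀ A x w) 0 := by
  have h := (hasDerivAt_hol_expCfg_mul V₀ A x w).mul_const ((((hol V₀ x w)⁻¹ : 𝔸ˣ) : 𝔸))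
  simp only [mul_assoc, Units.mul_inv, mul_one] at h
  simpa only [tHol, Units.val_mul] using h

/-- **(111) TO FIRST ORDER**: "(1/i) log(R_{0,y}V₁)(Γ_{y,x}) = (R_{0,y}A)(Γ_{y,x}) + O((|A|(Γ_{y,x}))²)" — here as the
exact first-order statement: the `t`-derivative at `0` of `log (R_{0,y}e^{tA})(Γ)` (`log` = the series (21)) is
`(R_{0,y}A)(Γ)`, for EVERY word `Γ` and every background (the curve passes through `1`, where `D log = id`:
`B7Eq78Linearization.hasDerivAt_mlog_comp`). The quantitative `O(·)` is part of the analyticity half of Prop. 3, not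
made here. [cite: Balaban1985Averaging, (111) p.34] -/
theorem hasDerivAt_mlog_tHol_expCfg (V₀ : Site d → Fin d → 𝔸ˣ) (A : Site d → Fin d → 𝔸) (x : Site d)
    (w : List (Letter d)) :
    HasDerivAt (fun t : ℂ => mlog ((tHol V₀ (expCfg (t • A)) x w : 𝔸ˣ) : 𝔸)) (tsum V₀ A x w) 0 :=
  hasDerivAt_mlog_comp (by rw [tHol_expCfg_zero_smul, Units.val_one]) (hasDerivAt_tHol_expCfg V₀ A x w)

end Derivative

end Literature.MathematicalPhysics.QuantumFieldTheory.Balaban1983to89.B7Prop3GeneralRotated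

end
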